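import Mathlib
import Literature.NumberTheory.LFunctions.Zhang2022.Section4Statements
import Literature.NumberTheory.LFunctions.Zhang2022.Section4PerronIntegrability
import Literature.NumberTheory.LFunctions.Zhang2022.Section4ContourShift
import Literature.NumberTheory.LFunctions.Zhang2022.SkeletonAssembly
import HarnessLib

/-!
# Zhang (2022) §4, proof of Lemma 4.4: the shifted-contour estimate behind (4.7)
# (`Section4.Contour47Bound`, `Section4.Ded47` DISCHARGED; theorem-only, campaign D-0069 wave 2)

Topic `Literature/NumberTheory/LFunctions/Zhang2022` (Landau–Siegel audit tree; verdict-neutral).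
Y. Zhang, *Discrete mean estimates and the Landau–Siegel zero*, arXiv:2211.02515v1 (2022)
[Zhang2022LandauSiegel] — an unrefereed manuscript under adjudication; nothing here asserts or
denies its Theorems 1–2.

§4 p. 20 (tex L1092–L1101): "To prove (4.7) we move the contour of integration to the vertical
segments `w = 10 + iv` with `|v| < 𝓛²⁰`, `w = −σ−1/2 + iv` with `|v| ≥ 𝓛²⁰`, and to the two
connecting horizontal segments `w = u ± i𝓛²⁰` with `−σ−1/2 ≤ u ≤ 10`. By a trivial bound for
`ω₁(w)`, (4.5) and the residue theorem we obtain (4.7)."  This file PROVES the estimate half of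
that sentence, the typed node `Section4.Contour47Bound` (`Section4Statements`, p411835): for
`s ∈ Ω₃`, every `ψ ∈ Ψ` and `D` large, the integral of `Z̃(s+w,ψ)F(1−s−w,ψ̄)P^{(9/5)w}ω₁(w)/w`
over the shifted contour is `≤ C·P⁻¹` (`c = 1`):

* tails `Re w = −σ−1/2`, `|v| ≥ 𝓛²⁰` (`tail_pt`, `tail_int`): on `Re(s+w) = −1/2` the "trivial
  bound" `|Z̃(s+w,ψ)| ≤ Dp²(1 + |s+w|)²` (`Section4PerronIntegrability.norm_tildeZW_le_of_re`,
  `|τ(θ)| = √k`), `|F(1−s−w,ψ̄)| ≤ D⁵²`, `P^{(9/5)Re w} ≤ 1`, and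
  `|ω₁(w)| = e^{(u²−v²)/(4𝓛³⁰)}`: the Gaussian tail gives `≪ D⁵³P²t₀²𝓛¹⁵e^{−𝓛¹⁰/12} ≤ C·P⁻¹`;
* middle segment `Re w = 10`, `|v| < 𝓛²⁰` (`mid_pt`): Stirling, uniformly in `t`
  (`GammaFactor.abs_norm_tildeZ_sub_le`, `A = 12`), gives
  `|Z̃(s+w,ψ)| ≤ 2(Dp²(t+v)²/4π²)^{1/2−σ−10} ≤ 2P^{1−2σ−20} ≤ 2e^{2π}P^{−20}` against `P^{18}` and
  `|F(1−s−w,ψ̄)| ≤ D⁵²`: `≪ 𝓛²⁰D⁵²P⁻² ≤ C·P⁻¹`;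
* horizontal segments `w = u ± i𝓛²⁰` (`hor_pt`): `|ω₁(u ± i𝓛²⁰)| ≤ e·e^{−𝓛¹⁰/4}`,
  `|Z̃(s+w,ψ)| ≤ 24DP²t₀²` (Stirling with exponent `≤ 1`), `P^{(9/5)u} ≤ P^{18}`:
  `≪ D⁵³P²⁰t₀²e^{−𝓛¹⁰/4} ≤ C·P⁻¹`.

Hence `contour47Bound_holds : Contour47Bound`, `ded47_holds : Ded47` and
`eq47_of_shift47 : Shift47 → Eq47`.  Typed-DAG note: the deduction node `Ded47 : Eq45 →
Contour47Bound` is discharged WITHOUT its hypothesis — (4.5) as printed (window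
`|Im(s − s₀)| < 𝓛₁ + 3`) does not cover `s + w` for `|v|` up to `𝓛²⁰` when `s` is near the edge of
`Ω₃`'s window; the `t`-uniform Stirling estimate is what "(4.5)" supplies in that sentence.

No new definitions, no new named facts; imports from the tree and Mathlib only.

## References

* Y. Zhang, arXiv:2211.02515v1 (2022), §4 pp. 19–20, proof of Lemma 4.4, (4.5), (4.7).
  [cite: Zhang2022LandauSiegel, §4 (4.7) (proof) p. 20]
* E. C. Titchmarsh, *The Theory of the Riemann Zeta-Function*, 2nd ed. (1986), §4.12 (4.12.3)
  (Stirling for `χ(s)`; the tree's `RiemannSiegelChiStirling`). [cite: Titchmarsh1986, §4.12 (4.12.3)]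
-/

noncomputable section

open Complex Real ComplexConjugate MeasureTheory Set

namespace Literature.NumberTheory.LFunctions.Zhang2022.Section4

open Skeleton

variable {D : ℕ}

/-! ## Elementary inputs -/

/-- `P < p < 2P` for `ψ (mod p) ∈ Ψ` (`p ∼ P`: `P < p < P(1 + 𝓛⁻⁶⁸)`), once `𝓛 ≥ 1`.
[cite: Zhang2022LandauSiegel, §2 (2.6) p. 5] -/
private theorem bigP_lt_p_lt (hL1 : 1 ≤ ell D) (x : Chr D) :
    bigP D < x.p ∧ (x.p : ℝ) < 2 * bigP D := by
  have hmem := x.mem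
  rw [primeWindow, Finset.mem_filter, Finset.mem_Ioo] at hmem
  obtain ⟨⟨h1, h2⟩, -⟩ := hmem
  have hP0 : 0 ≤ bigP D := (Real.exp_pos _).le
  refine ⟨(Nat.floor_lt hP0).mp h1, lt_of_lt_of_le (Nat.lt_ceil.mp h2) ?_⟩
  have hinv : (ell D ^ 68)⁻¹ ≤ 1 := inv_le_one_of_one_le₀ (one_le_pow₀ hL1)
  nlinarith

/-- `|ν(n)| ≤ τ(n) ≤ n`. [cite: Zhang2022LandauSiegel, §3 (3.1)] -/
private theorem norm_nu_le_self' [NeZero D] (χ : DirichletCharacter ℂ D) (n : ℕ) : ‖nu χ n‖ ≤ n := by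
  rw [nu, divisorSumChar_apply]
  calc ‖∑ d ∈ n.divisors, χ (d : ZMod D)‖ ≤ ∑ d ∈ n.divisors, ‖χ (d : ZMod D)‖ := norm_sum_le _ _
    _ ≤ ∑ d ∈ n.divisors, (1 : ℝ) := Finset.sum_le_sum fun d _ => χ.norm_le_one _
    _ = n.divisors.card := by simp
    _ ≤ n := by exact_mod_cast Nat.card_divisors_le_self n

/-- **Crude size of `F(z,ψ̄)` left of the critical strip**: `|F(z,ψ̄)| ≤ D⁵²` whenever `Re z ≥ −11`
(`Σ_{n≤D⁴}|ν(n)|n^{−Re z} ≤ D⁴·D⁴·(D⁴)¹¹`; "trivial bounds for the involved sum").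
[cite: Zhang2022LandauSiegel, §4 (4.7)–(4.9) (proof) p. 20] -/
theorem norm_FpolyBar_le_pow52 [NeZero D] (χ : DirichletCharacter ℂ D) (x : Chr D) {z : ℂ}
    (hz : -11 ≤ z.re) : ‖FpolyBar χ x z‖ ≤ (D : ℝ) ^ 52 := by
  have hD1 : (1 : ℝ) ≤ D := by exact_mod_cast Nat.one_le_iff_ne_zero.mpr (NeZero.ne D)
  have hD4 : (1 : ℝ) ≤ (D : ℝ) ^ 4 := one_le_pow₀ hD1
  unfold FpolyBar
  have hterm : ∀ n ∈ Finset.Icc 1 (D ^ 4),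
      ‖nu χ n * conj (x.ψ (n : ZMod x.p)) * (n : ℂ) ^ (-z)‖ ≤ (D : ℝ) ^ 4 * (D : ℝ) ^ 44 := by
    intro n hn
    obtain ⟨hn1, hn2⟩ := Finset.mem_Icc.mp hn
    have hn0 : 0 < n := hn1
    have hnR : (n : ℝ) ≤ (D : ℝ) ^ 4 := by exact_mod_cast hn2
    have hn1R : (1 : ℝ) ≤ n := by exact_mod_cast hn1
    rw [norm_mul, norm_mul, Complex.norm_natCast_cpow_of_pos hn0, Complex.neg_re]
    have h1 : ‖nu χ n‖ ≤ (D : ℝ) ^ 4 := (norm_nu_le_self' χ n).trans hnR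
    have h2 : ‖conj (x.ψ (n : ZMod x.p))‖ ≤ 1 := (Complex.norm_conj _).le.trans (x.ψ.norm_le_one _)
    have h3 : (n : ℝ) ^ (-z.re) ≤ (D : ℝ) ^ 44 := by
      calc (n : ℝ) ^ (-z.re) ≤ (n : ℝ) ^ (11 : ℝ) :=
            Real.rpow_le_rpow_of_exponent_le hn1R (by linarith)
        _ ≤ ((D : ℝ) ^ 4) ^ (11 : ℝ) := Real.rpow_le_rpow (by positivity) hnR (by norm_num)
        _ = (D : ℝ) ^ 44 := by rw [show (11 : ℝ) = (11 : ℕ) by norm_num, Real.rpow_natCast]; ring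
    calc ‖nu χ n‖ * ‖conj (x.ψ (n : ZMod x.p))‖ * (n : ℝ) ^ (-z.re)
        ≤ (D : ℝ) ^ 4 * 1 * (D : ℝ) ^ 44 := by
          refine mul_le_mul (mul_le_mul h1 h2 (norm_nonneg _) (by positivity)) h3
            (Real.rpow_nonneg (by positivity) _) (by positivity)
      _ = (D : ℝ) ^ 4 * (D : ℝ) ^ 44 := by ring
  calc ‖∑ n ∈ Finset.Icc 1 (D ^ 4), nu χ n * conj (x.ψ (n : ZMod x.p)) * (n : ℂ) ^ (-z)‖
      ≤ ∑ n ∈ Finset.Icc 1 (D ^ 4), (D : ℝ) ^ 4 * (D : ℝ) ^ 44 := norm_sum_le_of_le _ hterm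
    _ = (D ^ 4 : ℕ) * ((D : ℝ) ^ 4 * (D : ℝ) ^ 44) := by simp
    _ = (D : ℝ) ^ 52 := by push_cast; ring

/-- **`Z̃` on the line `Re = −1/2`** ("a trivial bound"): `|Z̃(z,ψ)| ≤ Dp²(1 + |z|)²`
(the tree's `norm_tildeZW_le_of_re` with `|τ(θ)| = √k` for the primitive `ψ`, `ψχ`).
[cite: Zhang2022LandauSiegel, §4 (4.7) (proof) p. 20] -/
theorem norm_tildeZW_le_of_re_neg_half [NeZero D] (χ : DirichletCharacter ℂ D) (x : Chr D)
    (hθ : (psiChi χ x).IsPrimitive) {z : ℂ} (hz : z.re = -1 / 2) :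
    ‖tildeZW χ x z‖ ≤ (D : ℝ) * (x.p : ℝ) ^ 2 * (1 + ‖z‖) ^ 2 := by
  have h := norm_tildeZW_le_of_re χ x hz
  rw [GammaFactor.norm_tau x.prim, GammaFactor.norm_tau hθ] at h
  have hp : (0 : ℝ) ≤ x.p := Nat.cast_nonneg _
  have hD : (0 : ℝ) ≤ D := Nat.cast_nonneg _
  have e1 : Real.sqrt (x.p : ℝ) * (x.p : ℝ) ^ (1 / 2 : ℝ) = x.p := by
    rw [Real.sqrt_eq_rpow, ← Real.rpow_add' hp (by norm_num)]; norm_num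
  have e2 : Real.sqrt ((D * x.p : ℕ) : ℝ) * ((D * x.p : ℕ) : ℝ) ^ (1 / 2 : ℝ) = D * x.p := by
    rw [Real.sqrt_eq_rpow, ← Real.rpow_add' (by positivity) (by norm_num)]; norm_num
  calc ‖tildeZW χ x z‖ ≤ _ := h
    _ = (D : ℝ) * (x.p : ℝ) ^ 2 * (1 + ‖z‖) ^ 2 := by rw [e1, e2]; ring

/-- **`Z̃` by Stirling, uniformly in the strip `|σ'| ≤ 12`, `t' ≥ 96330`**:
`|Z̃(σ'+it',ψ)| ≤ 2(Dp²(t'/2π)²)^{1/2−σ'}` (the tree's `abs_norm_tildeZ_sub_le`, `A = 12`,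
`570·13²/t' ≤ 1`) — the `t`-uniform content of (4.5). [cite: Zhang2022LandauSiegel, §4 (4.5) p. 18] -/
theorem norm_tildeZW_le_stirling [NeZero D] (χ : DirichletCharacter ℂ D) (x : Chr D)
    (hθ : (psiChi χ x).IsPrimitive) {σ' t' : ℝ} (hσ : |σ'| ≤ 12) (ht : 96330 ≤ t') :
    ‖tildeZW χ x (σ' + t' * I)‖ ≤
      2 * ((x.p : ℝ) * ((D * x.p : ℕ) : ℝ) * (t' / (2 * π)) ^ 2) ^ (1 / 2 - σ') := by
  have ht38 : 38 * ((12 : ℝ) + 1) ^ 2 ≤ t' := by norm_num; linarith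
  have key := GammaFactor.abs_norm_tildeZ_sub_le (ψ := x.ψ) (θ₂ := psiChi χ x) x.prim hθ
    (A := 12) (σ := σ') (t := t') (by norm_num) hσ ht38
  have hZeq : GammaFactor.tildeZ x.ψ (psiChi χ x) (σ' + t' * I) = tildeZW χ x (σ' + t' * I) := rfl
  rw [hZeq] at key
  set M := ((x.p : ℝ) * ((D * x.p : ℕ) : ℝ) * (t' / (2 * π)) ^ 2) ^ (1 / 2 - σ') with hM
  have hM0 : 0 ≤ M := Real.rpow_nonneg (by positivity) _
  have hc : 570 * ((12 : ℝ) + 1) ^ 2 / t' ≤ 1 := by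
    rw [div_le_one (by linarith)]; norm_num; linarith
  have h1 := (abs_le.mp key).2
  have h2 : 570 * ((12 : ℝ) + 1) ^ 2 / t' * M ≤ 1 * M := mul_le_mul_of_nonneg_right hc hM0
  linarith

/-- **Gaussian tail majorant**: for `0 < Λ`, `0 ≤ B`, `V ≤ |v|`:
`(B + |v|)²e^{−v²/(4Λ)} ≤ (2B² + 24Λ)e^{−V²/(12Λ)}·e^{−v²/(12Λ)}`. [folklore] -/
private theorem sq_mul_exp_le {Λ B V v : ℝ} (hΛ : 0 < Λ) (hV : 0 ≤ V) (hv : V ≤ |v|) :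
    (B + |v|) ^ 2 * Real.exp (-v ^ 2 / (4 * Λ))
      ≤ (2 * B ^ 2 + 24 * Λ) * Real.exp (-V ^ 2 / (12 * Λ)) * Real.exp (-v ^ 2 / (12 * Λ)) := by
  have hsplit : Real.exp (-v ^ 2 / (4 * Λ))
      = Real.exp (-v ^ 2 / (12 * Λ)) * Real.exp (-v ^ 2 / (12 * Λ)) * Real.exp (-v ^ 2 / (12 * Λ)) := by
    rw [← Real.exp_add, ← Real.exp_add]; congr 1; field_simp; ring
  have hE0 : 0 < Real.exp (-v ^ 2 / (12 * Λ)) := Real.exp_pos _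
  -- `v²e^{−v²/(12Λ)} ≤ 12Λ`
  have hx : v ^ 2 / (12 * Λ) * Real.exp (-(v ^ 2 / (12 * Λ))) ≤ 1 := by
    have h := Real.add_one_le_exp (v ^ 2 / (12 * Λ))
    have h0 : 0 ≤ v ^ 2 / (12 * Λ) := by positivity
    rw [Real.exp_neg, ← div_eq_mul_inv, div_le_one (Real.exp_pos _)]
    linarith
  have hv2 : v ^ 2 * Real.exp (-v ^ 2 / (12 * Λ)) ≤ 12 * Λ := by
    have : v ^ 2 * Real.exp (-v ^ 2 / (12 * Λ)) = 12 * Λ * (v ^ 2 / (12 * Λ) * Real.exp (-(v ^ 2 / (12 * Λ)))) := by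
      rw [neg_div]; field_simp
    rw [this]; nlinarith
  -- `e^{−v²/(12Λ)} ≤ e^{−V²/(12Λ)}`
  have hvV : Real.exp (-v ^ 2 / (12 * Λ)) ≤ Real.exp (-V ^ 2 / (12 * Λ)) := by
    rw [Real.exp_le_exp, neg_div, neg_div, neg_le_neg_iff]
    have hVv : V ^ 2 ≤ v ^ 2 := by
      calc V ^ 2 ≤ |v| ^ 2 := pow_le_pow_left₀ hV hv 2
        _ = v ^ 2 := sq_abs v
    exact div_le_div_of_nonneg_right hVv (by positivity)
  have hsq : (B + |v|) ^ 2 ≤ 2 * B ^ 2 + 2 * v ^ 2 := by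
    nlinarith [sq_nonneg (B - |v|), sq_abs v]
  calc (B + |v|) ^ 2 * Real.exp (-v ^ 2 / (4 * Λ))
      ≤ (2 * B ^ 2 + 2 * v ^ 2) * Real.exp (-v ^ 2 / (4 * Λ)) :=
        mul_le_mul_of_nonneg_right hsq (Real.exp_pos _).le
    _ = (2 * B ^ 2 * Real.exp (-v ^ 2 / (12 * Λ)) + 2 * (v ^ 2 * Real.exp (-v ^ 2 / (12 * Λ))))
          * Real.exp (-v ^ 2 / (12 * Λ)) * Real.exp (-v ^ 2 / (12 * Λ)) := by rw [hsplit]; ring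
    _ ≤ (2 * B ^ 2 * 1 + 2 * (12 * Λ)) * Real.exp (-V ^ 2 / (12 * Λ)) * Real.exp (-v ^ 2 / (12 * Λ)) := by
        gcongr
        · rw [show -v ^ 2 / (12 * Λ) = -(v ^ 2 / (12 * Λ)) by ring]
          exact Real.exp_le_one_iff.mpr (by simp; positivity)
    _ = (2 * B ^ 2 + 24 * Λ) * Real.exp (-V ^ 2 / (12 * Λ)) * Real.exp (-v ^ 2 / (12 * Λ)) := by ring

/-! ## Exponential bookkeeping in `𝓛` (`D = e^𝓛`, `P = e^{𝓛⁹}`, `t₀ = 𝓛⁵¹⁹`, `𝓛₁ = 𝓛⁴⁰⁵`) -/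

/-- `L^k ≤ e^{kL}` for `L ≥ 0`. [folklore] -/
private theorem pow_le_exp_mul {L : ℝ} (hL : 0 ≤ L) (k : ℕ) : L ^ k ≤ Real.exp (k * L) := by
  rw [Real.exp_nat_mul]
  exact pow_le_pow_left₀ hL (by linarith [Real.add_one_le_exp L]) k

/-- Middle segment: `2𝓛²⁰D⁵² ≤ P`. [cite: Zhang2022LandauSiegel, §4 (4.7) (proof) p. 20] -/
private theorem arith_mid {L : ℝ} (hL : 100 ≤ L) :
    2 * L ^ 20 * Real.exp L ^ 52 ≤ Real.exp (L ^ 9) := by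
  have hL0 : 0 ≤ L := by linarith
  have h20 := pow_le_exp_mul hL0 20
  have h2 : (2 : ℝ) ≤ Real.exp L := by linarith [Real.add_one_le_exp L]
  have hL8 : (100 : ℝ) ^ 8 ≤ L ^ 8 := pow_le_pow_left₀ (by norm_num) hL 8
  calc 2 * L ^ 20 * Real.exp L ^ 52 ≤ Real.exp L * Real.exp ((20 : ℕ) * L) * Real.exp L ^ 52 := by
        gcongr
    _ = Real.exp (73 * L) := by
        rw [← Real.exp_nat_mul L 52, ← Real.exp_add, ← Real.exp_add]; push_cast; ring_nf
    _ ≤ Real.exp (L ^ 9) := by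
        rw [Real.exp_le_exp]
        have : L ^ 9 = L * L ^ 8 := by ring
        nlinarith

/-- Horizontal segments: `D⁵³P²⁰t₀'²·e^{−𝓛¹⁰/4} ≤ P⁻¹` (`t₀' = 𝓛⁵¹⁹`).
[cite: Zhang2022LandauSiegel, §4 (4.7) (proof) p. 20] -/
private theorem arith_hor {L : ℝ} (hL : 100 ≤ L) :
    Real.exp L ^ 53 * Real.exp (L ^ 9) ^ (18 : ℝ) * Real.exp (L ^ 9) ^ 2 * (L ^ 519) ^ 2 *
        Real.exp (-(L ^ 10 / 4)) ≤ Real.exp (-(L ^ 9)) := by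
  have hL0 : 0 ≤ L := by linarith
  have h1038 : (L ^ 519) ^ 2 ≤ Real.exp ((1038 : ℕ) * L) := by
    rw [← pow_mul]; exact pow_le_exp_mul hL0 1038
  have hL8 : (100 : ℝ) ^ 8 ≤ L ^ 8 := pow_le_pow_left₀ (by norm_num) hL 8
  calc Real.exp L ^ 53 * Real.exp (L ^ 9) ^ (18 : ℝ) * Real.exp (L ^ 9) ^ 2 * (L ^ 519) ^ 2 *
        Real.exp (-(L ^ 10 / 4))
      ≤ Real.exp L ^ 53 * Real.exp (L ^ 9) ^ (18 : ℝ) * Real.exp (L ^ 9) ^ 2 *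
          Real.exp ((1038 : ℕ) * L) * Real.exp (-(L ^ 10 / 4)) := by gcongr
    _ = Real.exp (53 * L + 18 * L ^ 9 + 2 * L ^ 9 + 1038 * L - L ^ 10 / 4) := by
        rw [← Real.exp_nat_mul L 53, ← Real.exp_mul, ← Real.exp_nat_mul (L ^ 9) 2, ← Real.exp_add,
          ← Real.exp_add, ← Real.exp_add, ← Real.exp_add]
        push_cast; ring_nf
    _ ≤ Real.exp (-(L ^ 9)) := by
        rw [Real.exp_le_exp]
        have h9 : L ^ 9 = L * L ^ 8 := by ring
        have h10 : L ^ 10 = L * L * L ^ 8 := by ring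
        nlinarith [mul_le_mul_of_nonneg_left hL8 hL0]

/-- Tails: `D⁵³P²(2B² + 24𝓛³⁰)√(𝓛³⁰)·e^{−𝓛¹⁰/12} ≤ P⁻¹` with `B = 2 + 9𝓛⁵¹⁹`.
[cite: Zhang2022LandauSiegel, §4 (4.7) (proof) p. 20] -/
private theorem arith_tail {L : ℝ} (hL : 100 ≤ L) :
    Real.exp L ^ 53 * Real.exp (L ^ 9) ^ 2 * (2 * (2 + 9 * L ^ 519) ^ 2 + 24 * L ^ 30) *
        Real.sqrt (L ^ 30) * Real.exp (-(L ^ 10 / 12)) ≤ Real.exp (-(L ^ 9)) := by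
  have hL0 : 0 ≤ L := by linarith
  have hL1 : 1 ≤ L := by linarith
  have hsqrt : Real.sqrt (L ^ 30) = L ^ 15 := by
    rw [show L ^ 30 = (L ^ 15) ^ 2 by ring, Real.sqrt_sq (by positivity)]
  have hT1 : 1 ≤ L ^ 519 := one_le_pow₀ hL1
  have h30 : L ^ 30 ≤ L ^ 1038 := pow_le_pow_right₀ hL1 (by norm_num)
  have hB : 2 * (2 + 9 * L ^ 519) ^ 2 + 24 * L ^ 30 ≤ 266 * L ^ 1038 := by
    have : (2 + 9 * L ^ 519) ^ 2 ≤ (11 * L ^ 519) ^ 2 :=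
      pow_le_pow_left₀ (by positivity) (by linarith) 2
    have e : (11 * L ^ 519) ^ 2 = 121 * L ^ 1038 := by ring
    linarith
  have h1055 : (2 * (2 + 9 * L ^ 519) ^ 2 + 24 * L ^ 30) * L ^ 15 ≤ Real.exp ((1055 : ℕ) * L) := by
    have hp := pow_le_exp_mul hL0 1055
    have hL2 : (266 : ℝ) ≤ L ^ 2 := by nlinarith
    calc (2 * (2 + 9 * L ^ 519) ^ 2 + 24 * L ^ 30) * L ^ 15 ≤ 266 * L ^ 1038 * L ^ 15 :=
          mul_le_mul_of_nonneg_right hB (by positivity)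
      _ = 266 * L ^ 1053 := by ring
      _ ≤ L ^ 2 * L ^ 1053 := mul_le_mul_of_nonneg_right hL2 (by positivity)
      _ = L ^ 1055 := by ring
      _ ≤ _ := hp
  have hL8 : (100 : ℝ) ^ 8 ≤ L ^ 8 := pow_le_pow_left₀ (by norm_num) hL 8
  calc Real.exp L ^ 53 * Real.exp (L ^ 9) ^ 2 * (2 * (2 + 9 * L ^ 519) ^ 2 + 24 * L ^ 30) *
        Real.sqrt (L ^ 30) * Real.exp (-(L ^ 10 / 12))
      = Real.exp L ^ 53 * Real.exp (L ^ 9) ^ 2 * ((2 * (2 + 9 * L ^ 519) ^ 2 + 24 * L ^ 30) * L ^ 15) *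
          Real.exp (-(L ^ 10 / 12)) := by rw [hsqrt]; ring
    _ ≤ Real.exp L ^ 53 * Real.exp (L ^ 9) ^ 2 * Real.exp ((1055 : ℕ) * L) *
          Real.exp (-(L ^ 10 / 12)) :=
        mul_le_mul_of_nonneg_right (mul_le_mul_of_nonneg_left h1055 (by positivity)) (by positivity)
    _ = Real.exp (53 * L + 2 * L ^ 9 + 1055 * L - L ^ 10 / 12) := by
        rw [← Real.exp_nat_mul L 53, ← Real.exp_nat_mul (L ^ 9) 2, ← Real.exp_add, ← Real.exp_add,
          ← Real.exp_add]
        push_cast; ring_nf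
    _ ≤ Real.exp (-(L ^ 9)) := by
        rw [Real.exp_le_exp]
        have h9 : L ^ 9 = L * L ^ 8 := by ring
        have h10 : L ^ 10 = L * L * L ^ 8 := by ring
        nlinarith [mul_le_mul_of_nonneg_left hL8 hL0]

/-- `‖(1/(2π) : ℂ)‖ ≤ 1`. [folklore] -/
private theorem norm_one_div_two_pi_le : ‖(1 / (2 * π) : ℂ)‖ ≤ 1 := by
  rw [show (1 / (2 * π) : ℂ) = ((1 / (2 * π) : ℝ) : ℂ) by push_cast; ring, Complex.norm_real,
    Real.norm_of_nonneg (by positivity), div_le_one (by positivity)]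
  linarith [Real.pi_gt_three]

/-- `‖(1/(2πi) : ℂ)‖ ≤ 1`. [folklore] -/
private theorem norm_one_div_two_pi_I_le : ‖(1 / (2 * π * I) : ℂ)‖ ≤ 1 := by
  rw [norm_div, norm_one, norm_mul, norm_mul, Complex.norm_I, mul_one, Complex.norm_real,
    Real.norm_of_nonneg Real.pi_pos.le, Complex.norm_two, div_le_one (by positivity)]
  linarith [Real.pi_gt_three]

/-! ## (4.7): the shifted contour is `O(P⁻¹)` -/

/-- The parameter window of the proof of (4.7): for `𝓛 ≥ 100` and `s ∈ Ω₃`,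
`0 < σ < 3/2`, `5t₀ ≤ t − 𝓛²⁰`, `t + 𝓛²⁰ ≤ 9t₀`, `t₀ ≥ 96330`, `𝓛²⁰ ≥ 1`.
[cite: Zhang2022LandauSiegel, §4 Lemma 4.4 p. 19] -/
private theorem window_facts (hL : 100 ≤ ell D) {s : ℂ} (hs : s ∈ Omega3 D) :
    0 < s.re ∧ s.re < 3 / 2 ∧ 5 * t0 D ≤ s.im - ell D ^ 20 ∧ s.im + ell D ^ 20 ≤ 9 * t0 D ∧
      96330 ≤ t0 D ∧ 1 ≤ ell D ^ 20 := by
  have hL1 : 1 ≤ ell D := by linarith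
  obtain ⟨hσ1, hσ2, ht⟩ := hs
  have hαdef : alpha D = π / ell D ^ 9 := by rw [alpha, bigP, Real.log_exp]
  have h9 : (100 : ℝ) ^ 9 ≤ ell D ^ 9 := pow_le_pow_left₀ (by norm_num) hL 9
  have hαhalf : alpha D ≤ 1 / 2 := by
    rw [hαdef, div_le_iff₀ (by positivity)]
    nlinarith [Real.pi_lt_four]
  have hα0 : 0 < alpha D := by rw [hαdef]; positivity
  have hT : t0 D = ell D ^ 519 := rfl
  have hV : ell1 D = ell D ^ 405 := rfl
  have h3 : (100 : ℝ) ^ 3 ≤ ell D ^ 3 := pow_le_pow_left₀ (by norm_num) hL 3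
  have hT3 : ell D ^ 3 ≤ ell D ^ 519 := pow_le_pow_right₀ hL1 (by norm_num)
  have h114 : (100 : ℝ) ^ 3 ≤ ell D ^ 114 := h3.trans (pow_le_pow_right₀ hL1 (by norm_num))
  have h1 : ell D ^ 405 * ell D ^ 114 = ell D ^ 519 := by ring
  have h2 : ell D ^ 20 ≤ ell D ^ 405 := pow_le_pow_right₀ hL1 (by norm_num)
  have h405 : (1 : ℝ) ≤ ell D ^ 405 := one_le_pow₀ hL1
  have hwin : ell D ^ 405 + 3 + ell D ^ 20 ≤ ell D ^ 519 := by nlinarith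
  obtain ⟨ht1, ht2⟩ := abs_lt.mp ht
  rw [hV] at ht1 ht2
  rw [hT]
  refine ⟨by linarith, by linarith, ?_, ?_, by linarith, one_le_pow₀ hL1⟩
  · nlinarith [Real.pi_gt_three]
  · nlinarith [Real.pi_lt_four]

/-- The Gaussian factor: `e^{(u²−v²)/(4𝓛³⁰)} ≤ e·e^{−v²/(4𝓛³⁰)}` for `u² ≤ 144 ≤ 4𝓛³⁰`.
[cite: Zhang2022LandauSiegel, §4 (4.7) (proof) p. 20] -/
private theorem exp_factor_le (hL : 100 ≤ ell D) {u : ℝ} (v : ℝ) (hu : u ^ 2 ≤ 144) :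
    Real.exp ((u ^ 2 - v ^ 2) / (4 * ell D ^ 30))
      ≤ Real.exp 1 * Real.exp (-v ^ 2 / (4 * ell D ^ 30)) := by
  have hL1 : 1 ≤ ell D := by linarith
  have hΛ : 144 ≤ 4 * ell D ^ 30 := by
    have : ell D ≤ ell D ^ 30 := le_self_pow₀ hL1 (by norm_num)
    linarith
  rw [← Real.exp_add, Real.exp_le_exp, sub_div, neg_div]
  have : u ^ 2 / (4 * ell D ^ 30) ≤ 1 := by rw [div_le_one (by positivity)]; linarith
  linarith

section Pieces

variable [NeZero D] (χ : DirichletCharacter ℂ D) (x : Chr D)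

/-- `|F(1−s−w,ψ̄)| ≤ D⁵²` along the whole contour (`Re w ≤ 10`, `σ < 3/2`).
[cite: Zhang2022LandauSiegel, §4 (4.7) (proof) p. 20] -/
private theorem norm_FpolyBar_shift_le {s w : ℂ} (hσ : s.re < 3 / 2) (hw : w.re ≤ 10) :
    ‖FpolyBar χ x (1 - s - w)‖ ≤ (D : ℝ) ^ 52 := by
  refine norm_FpolyBar_le_pow52 χ x ?_
  simp only [Complex.sub_re, Complex.one_re]
  linarith

/-- **Middle segment** `w = 10 + iv`, `|v| ≤ 𝓛²⁰`: pointwise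
`|f₄₇(w)P^{(9/5)w}ω₁(w)/w| ≤ (e^{2π}e/5)·D⁵²P⁻²` (Stirling: `|Z̃(s+w)| ≤ 2e^{2π}P^{−20}`).
[cite: Zhang2022LandauSiegel, §4 (4.7) (proof) p. 20] -/
private theorem mid_pt (hL : 100 ≤ ell D) (hθ : (psiChi χ x).IsPrimitive)
    (hPp : bigP D < x.p) {s : ℂ} (hs : s ∈ Omega3 D) {v : ℝ} (hv : |v| ≤ ell D ^ 20) :
    ‖perronIntegrand D (f47 χ x s) ((10 : ℝ) + v * I)‖
      ≤ Real.exp (2 * π) * Real.exp 1 / 5 * ((D : ℝ) ^ 52 * bigP D ^ (-2 : ℝ)) := by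
  obtain ⟨hσlo, hσhi, htlo, hthi, hTbig, hV1⟩ := window_facts hL hs
  have hσ1 : 1 / 2 - alpha D < s.re := hs.1
  have hP1 : 1 ≤ bigP D := Real.one_le_exp (by positivity)
  have hP0 : 0 < bigP D := by linarith
  have hp0 : (0 : ℝ) < x.p := by linarith
  have hD1 : (1 : ℝ) ≤ D := by exact_mod_cast Nat.one_le_iff_ne_zero.mpr (NeZero.ne D)
  have hαdef : alpha D = π / ell D ^ 9 := by rw [alpha, bigP, Real.log_exp]
  obtain ⟨hv1, hv2⟩ := abs_le.mp hv
  rw [norm_perronIntegrand]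
  -- Z̃ by Stirling
  have hsw : s + ((10 : ℝ) + v * I) = ((s.re + 10 : ℝ) : ℂ) + ((s.im + v : ℝ) : ℂ) * I := by
    apply Complex.ext <;> simp
  have htv : 96330 ≤ s.im + v := by linarith
  have hT8 : 8 ≤ t0 D := by linarith
  have hZ := norm_tildeZW_le_stirling χ x hθ (σ' := s.re + 10) (t' := s.im + v)
    (abs_le.mpr ⟨by linarith, by linarith⟩) htv
  clear hTbig htv
  -- nonnegativity facts (stated before the context grows)
  have hn18 : 0 ≤ bigP D ^ (18 : ℝ) := Real.rpow_nonneg hP0.le _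
  have hn20 : 0 ≤ bigP D ^ (-20 : ℝ) := Real.rpow_nonneg hP0.le _
  have hnK : 0 ≤ 2 * (Real.exp (2 * π) * bigP D ^ (-20 : ℝ)) := by positivity
  have hnK' : 0 ≤ 2 * (Real.exp (2 * π) * bigP D ^ (-20 : ℝ)) * (D : ℝ) ^ 52 := by positivity
  have hbaseP : bigP D ^ 2 ≤ (x.p : ℝ) * ((D * x.p : ℕ) : ℝ) * ((s.im + v) / (2 * π)) ^ 2 := by
    have h1 : bigP D ≤ x.p := hPp.le
    have h2 : bigP D ≤ ((D * x.p : ℕ) : ℝ) := by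
      push_cast
      calc bigP D ≤ (x.p : ℝ) := h1
        _ = 1 * x.p := (one_mul _).symm
        _ ≤ D * x.p := mul_le_mul_of_nonneg_right hD1 hp0.le
    have h3 : 1 ≤ ((s.im + v) / (2 * π)) ^ 2 := by
      have : 1 ≤ (s.im + v) / (2 * π) := by
        rw [le_div_iff₀ (by positivity)]; nlinarith [Real.pi_lt_four, hT8]
      nlinarith
    calc bigP D ^ 2 = bigP D * bigP D * 1 := by ring
      _ ≤ (x.p : ℝ) * ((D * x.p : ℕ) : ℝ) * ((s.im + v) / (2 * π)) ^ 2 :=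
          mul_le_mul (mul_le_mul h1 h2 hP0.le hp0.le) h3 zero_le_one (by positivity)
  have hZ' : ‖tildeZW χ x (s + ((10 : ℝ) + v * I))‖ ≤ 2 * (Real.exp (2 * π) * bigP D ^ (-20 : ℝ)) := by
    rw [hsw]
    refine hZ.trans (mul_le_mul_of_nonneg_left ?_ (by norm_num))
    calc ((x.p : ℝ) * ((D * x.p : ℕ) : ℝ) * ((s.im + v) / (2 * π)) ^ 2) ^ (1 / 2 - (s.re + 10))
        ≤ (bigP D ^ 2) ^ (1 / 2 - (s.re + 10)) :=
          Real.rpow_le_rpow_of_nonpos (by positivity) hbaseP (by linarith)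
      _ = bigP D ^ (2 * (1 / 2 - (s.re + 10))) := by
          rw [← Real.rpow_natCast, ← Real.rpow_mul hP0.le]; norm_num
      _ ≤ bigP D ^ (2 * alpha D + (-20 : ℝ)) :=
          Real.rpow_le_rpow_of_exponent_le hP1 (by linarith)
      _ = Real.exp (2 * π) * bigP D ^ (-20 : ℝ) := by
          rw [Real.rpow_add hP0, bigP, ← Real.exp_mul, hαdef]
          congr 2; field_simp
  have hFw := norm_FpolyBar_shift_le χ x (w := (10 : ℝ) + v * I) hσhi (by simp)
  have hf : ‖f47 χ x s ((10 : ℝ) + v * I)‖ ≤ 2 * (Real.exp (2 * π) * bigP D ^ (-20 : ℝ)) * (D : ℝ) ^ 52 := by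
    rw [f47, norm_mul]
    exact mul_le_mul hZ' hFw (norm_nonneg _) hnK
  have hPw : bigP D ^ ((9 / 5 : ℝ) * 10) = bigP D ^ (18 : ℝ) := by norm_num
  have hω1 : Real.exp ((10 ^ 2 - v ^ 2) / (4 * ell D ^ 30)) ≤ Real.exp 1 := by
    refine (exp_factor_le hL v (u := 10) (by norm_num)).trans ?_
    have : Real.exp (-v ^ 2 / (4 * ell D ^ 30)) ≤ 1 := by
      rw [Real.exp_le_one_iff, neg_div]; exact neg_nonpos.mpr (by positivity)
    have h0 : 0 < Real.exp 1 := Real.exp_pos 1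
    nlinarith
  have hwn : 10 ≤ ‖((10 : ℝ) : ℂ) + (v : ℂ) * I‖ := by
    have := Complex.abs_re_le_norm (((10 : ℝ) : ℂ) + (v : ℂ) * I)
    simpa using this
  rw [hPw]
  have hK0 : 0 ≤ 2 * (Real.exp (2 * π) * bigP D ^ (-20 : ℝ)) * (D : ℝ) ^ 52 * bigP D ^ (18 : ℝ) *
      Real.exp 1 := mul_nonneg (mul_nonneg hnK' hn18) (Real.exp_pos 1).le
  calc ‖f47 χ x s ((10 : ℝ) + v * I)‖ * bigP D ^ (18 : ℝ) *
        Real.exp ((10 ^ 2 - v ^ 2) / (4 * ell D ^ 30)) / ‖((10 : ℝ) : ℂ) + (v : ℂ) * I‖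
      ≤ (2 * (Real.exp (2 * π) * bigP D ^ (-20 : ℝ)) * (D : ℝ) ^ 52 * bigP D ^ (18 : ℝ) *
          Real.exp 1) / 10 := by
        refine div_le_div₀ hK0 ?_ (by norm_num) hwn
        exact mul_le_mul (mul_le_mul_of_nonneg_right hf hn18) hω1 (Real.exp_pos _).le
          (mul_nonneg hnK' hn18)
    _ = Real.exp (2 * π) * Real.exp 1 / 5 * ((D : ℝ) ^ 52 * (bigP D ^ (-20 : ℝ) * bigP D ^ (18 : ℝ))) := by
        ring
    _ = Real.exp (2 * π) * Real.exp 1 / 5 * ((D : ℝ) ^ 52 * bigP D ^ (-2 : ℝ)) := by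
        rw [← Real.rpow_add hP0]; norm_num

/-- **Horizontal segments** `w = u ± i𝓛²⁰` (`V = ±𝓛²⁰`), `−σ−1/2 < u ≤ 10`: pointwise
`|f₄₇(w)P^{(9/5)w}ω₁(w)/w| ≤ 24e·D⁵³P¹⁸P²t₀²·e^{−𝓛¹⁰/4}`.
[cite: Zhang2022LandauSiegel, §4 (4.7) (proof) p. 20] -/
private theorem hor_pt (hL : 100 ≤ ell D) (hθ : (psiChi χ x).IsPrimitive)
    (hPp : bigP D < x.p) (hp2 : (x.p : ℝ) < 2 * bigP D) {s : ℂ} (hs : s ∈ Omega3 D)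
    {V : ℝ} (hVabs : |V| = ell D ^ 20) {u : ℝ} (hu : u ∈ Set.uIoc (-s.re - 1 / 2) 10) :
    ‖perronIntegrand D (f47 χ x s) ((u : ℂ) + (V : ℂ) * I)‖
      ≤ 24 * Real.exp 1 * ((D : ℝ) ^ 53 * bigP D ^ (18 : ℝ) * bigP D ^ 2 * t0 D ^ 2 *
          Real.exp (-(ell D ^ 10 / 4))) := by
  obtain ⟨hσlo, hσhi, htlo, hthi, hTbig, hV1⟩ := window_facts hL hs
  have hP1 : 1 ≤ bigP D := Real.one_le_exp (by positivity)
  have hP0 : 0 < bigP D := by linarith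
  have hp0 : (0 : ℝ) < x.p := by linarith
  have hD1 : (1 : ℝ) ≤ D := by exact_mod_cast Nat.one_le_iff_ne_zero.mpr (NeZero.ne D)
  rw [Set.uIoc_of_le (by linarith)] at hu
  obtain ⟨hu1, hu2⟩ := hu
  have hVsq : V ^ 2 = ell D ^ 40 := by rw [← sq_abs, hVabs]; ring
  have hVrange : -ell D ^ 20 ≤ V ∧ V ≤ ell D ^ 20 := abs_le.mp hVabs.le
  have htv1 : 5 * t0 D ≤ s.im + V := by linarith [hVrange.1]
  have htv2 : s.im + V ≤ 9 * t0 D := by linarith [hVrange.2]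
  have htv3 : 96330 ≤ s.im + V := by linarith
  have hT8 : 8 ≤ t0 D := by linarith
  clear hTbig
  -- nonnegativity facts (stated before the context grows)
  have hn18 : 0 ≤ bigP D ^ (18 : ℝ) := Real.rpow_nonneg hP0.le _
  have hnu : 0 ≤ bigP D ^ ((9 / 5 : ℝ) * u) := Real.rpow_nonneg hP0.le _
  have hnX : 0 ≤ 2 * (12 * (D : ℝ) * bigP D ^ 2 * t0 D ^ 2) := by positivity
  have hnX' : 0 ≤ 2 * (12 * (D : ℝ) * bigP D ^ 2 * t0 D ^ 2) * (D : ℝ) ^ 52 := by positivity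
  have hnX'' : 0 ≤ 2 * (12 * (D : ℝ) * bigP D ^ 2 * t0 D ^ 2) * (D : ℝ) ^ 52 * bigP D ^ (18 : ℝ) :=
    mul_nonneg hnX' hn18
  rw [norm_perronIntegrand]
  -- Z̃ by Stirling (exponent ≤ 1)
  have hsw : s + ((u : ℂ) + (V : ℂ) * I) = ((s.re + u : ℝ) : ℂ) + ((s.im + V : ℝ) : ℂ) * I := by
    apply Complex.ext <;> simp
  have hZ := norm_tildeZW_le_stirling χ x hθ (σ' := s.re + u) (t' := s.im + V)
    (abs_le.mpr ⟨by linarith, by linarith⟩) htv3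
  clear htv3
  have hq1 : 1 ≤ (s.im + V) / (2 * π) := by
    rw [le_div_iff₀ (by positivity)]; nlinarith [Real.pi_lt_four, hT8]
  have hq2 : (s.im + V) / (2 * π) ≤ 3 / 2 * t0 D := by
    rw [div_le_iff₀ (by positivity)]; nlinarith [Real.pi_gt_three]
  have hbase1 : 1 ≤ (x.p : ℝ) * ((D * x.p : ℕ) : ℝ) * ((s.im + V) / (2 * π)) ^ 2 := by
    have h1 : 1 ≤ (x.p : ℝ) := le_trans hP1 hPp.le
    have h2 : 1 ≤ ((D * x.p : ℕ) : ℝ) := by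
      push_cast
      calc (1 : ℝ) = 1 * 1 := (one_mul _).symm
        _ ≤ D * x.p := mul_le_mul hD1 h1 zero_le_one (by positivity)
    have h3 : 1 ≤ ((s.im + V) / (2 * π)) ^ 2 := by nlinarith
    calc (1 : ℝ) = 1 * 1 * 1 := by ring
      _ ≤ _ := mul_le_mul (mul_le_mul h1 h2 zero_le_one (by positivity)) h3 zero_le_one (by positivity)
  have hbaseT : (x.p : ℝ) * ((D * x.p : ℕ) : ℝ) * ((s.im + V) / (2 * π)) ^ 2
      ≤ 12 * (D : ℝ) * bigP D ^ 2 * t0 D ^ 2 := by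
    have h1 : (x.p : ℝ) ≤ 2 * bigP D := hp2.le
    have h2 : ((D * x.p : ℕ) : ℝ) ≤ D * (2 * bigP D) := by
      push_cast; exact mul_le_mul_of_nonneg_left h1 (by positivity)
    have h3 : ((s.im + V) / (2 * π)) ^ 2 ≤ 3 * t0 D ^ 2 := by nlinarith
    calc (x.p : ℝ) * ((D * x.p : ℕ) : ℝ) * ((s.im + V) / (2 * π)) ^ 2
        ≤ (2 * bigP D) * (D * (2 * bigP D)) * (3 * t0 D ^ 2) :=
          mul_le_mul (mul_le_mul h1 h2 (by positivity) (by positivity)) h3 (by positivity) (by positivity)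
      _ = 12 * (D : ℝ) * bigP D ^ 2 * t0 D ^ 2 := by ring
  have hZ' : ‖tildeZW χ x (s + ((u : ℂ) + (V : ℂ) * I))‖ ≤ 2 * (12 * (D : ℝ) * bigP D ^ 2 * t0 D ^ 2) := by
    rw [hsw]
    refine hZ.trans (mul_le_mul_of_nonneg_left ?_ (by norm_num))
    calc ((x.p : ℝ) * ((D * x.p : ℕ) : ℝ) * ((s.im + V) / (2 * π)) ^ 2) ^ (1 / 2 - (s.re + u))
        ≤ ((x.p : ℝ) * ((D * x.p : ℕ) : ℝ) * ((s.im + V) / (2 * π)) ^ 2) ^ (1 : ℝ) :=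
          Real.rpow_le_rpow_of_exponent_le hbase1 (by linarith)
      _ = _ := Real.rpow_one _
      _ ≤ _ := hbaseT
  have hFw := norm_FpolyBar_shift_le χ x (w := (u : ℂ) + (V : ℂ) * I) hσhi (by simp; linarith)
  have hf : ‖f47 χ x s ((u : ℂ) + (V : ℂ) * I)‖
      ≤ 2 * (12 * (D : ℝ) * bigP D ^ 2 * t0 D ^ 2) * (D : ℝ) ^ 52 := by
    rw [f47, norm_mul]
    exact mul_le_mul hZ' hFw (norm_nonneg _) hnX
  have hPw : bigP D ^ ((9 / 5 : ℝ) * u) ≤ bigP D ^ (18 : ℝ) :=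
    Real.rpow_le_rpow_of_exponent_le hP1 (by linarith)
  have hid : -ell D ^ 40 / (4 * ell D ^ 30) = -(ell D ^ 10 / 4) := by
    rw [div_eq_iff (by positivity)]; ring
  have hωw : Real.exp ((u ^ 2 - V ^ 2) / (4 * ell D ^ 30))
      ≤ Real.exp 1 * Real.exp (-(ell D ^ 10 / 4)) := by
    have hprod : 0 ≤ (10 - u) * (u + 2) := mul_nonneg (by linarith only [hu2]) (by linarith only [hu1, hσhi])
    have hsq : u ^ 2 = 8 * u + 20 - (10 - u) * (u + 2) := by ring
    have hu2' : u ^ 2 ≤ 144 := by linarith only [hprod, hsq, hu2]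
    have h := exp_factor_le hL V hu2'
    rw [hVsq] at h ⊢
    rw [hid] at h
    exact h
  have hwn : 1 ≤ ‖(u : ℂ) + (V : ℂ) * I‖ := by
    have := Complex.abs_im_le_norm ((u : ℂ) + (V : ℂ) * I)
    simp only [Complex.add_im, Complex.ofReal_im, Complex.mul_im, Complex.ofReal_re, Complex.I_im,
      Complex.I_re, mul_zero, mul_one, zero_add, add_zero] at this
    rw [hVabs] at this
    linarith
  calc ‖f47 χ x s ((u : ℂ) + (V : ℂ) * I)‖ * bigP D ^ ((9 / 5 : ℝ) * u) *
        Real.exp ((u ^ 2 - V ^ 2) / (4 * ell D ^ 30)) / ‖(u : ℂ) + (V : ℂ) * I‖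
      ≤ ‖f47 χ x s ((u : ℂ) + (V : ℂ) * I)‖ * bigP D ^ ((9 / 5 : ℝ) * u) *
        Real.exp ((u ^ 2 - V ^ 2) / (4 * ell D ^ 30)) :=
        div_le_self (mul_nonneg (mul_nonneg (norm_nonneg _) hnu) (Real.exp_pos _).le) hwn
    _ ≤ 2 * (12 * (D : ℝ) * bigP D ^ 2 * t0 D ^ 2) * (D : ℝ) ^ 52 * bigP D ^ (18 : ℝ) *
        (Real.exp 1 * Real.exp (-(ell D ^ 10 / 4))) :=
        mul_le_mul (mul_le_mul hf hPw hnu hnX') hωw (Real.exp_pos _).le hnX''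
    _ = _ := by ring

/-- **Tails** `w = −σ−1/2 + iv`, `|v| ≥ 𝓛²⁰`: pointwise
`|f₄₇(w)P^{(9/5)w}ω₁(w)/w| ≤ G_T·e^{−v²/(12𝓛³⁰)}` ("a trivial bound for `ω₁(w)`"; on
`Re(s+w) = −1/2`, `|Z̃(s+w)| ≤ Dp²(1+|s+w|)²`). [cite: Zhang2022LandauSiegel, §4 (4.7) (proof) p. 20] -/
private theorem tail_pt (hL : 100 ≤ ell D) (hθ : (psiChi χ x).IsPrimitive)
    (hPp : bigP D < x.p) (hp2 : (x.p : ℝ) < 2 * bigP D) {s : ℂ} (hs : s ∈ Omega3 D)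
    {v : ℝ} (hv : ell D ^ 20 ≤ |v|) :
    ‖perronIntegrand D (f47 χ x s) (((-s.re - 1 / 2 : ℝ) : ℂ) + v * I)‖
      ≤ (4 * Real.exp 1 * ((D : ℝ) ^ 53 * bigP D ^ 2) * ((2 * (2 + 9 * t0 D) ^ 2 + 24 * ell D ^ 30) * Real.exp (-(ell D ^ 20) ^ 2 / (12 * ell D ^ 30)))) * Real.exp (-(1 / (12 * ell D ^ 30)) * v ^ 2) := by
  obtain ⟨hσlo, hσhi, htlo, hthi, -, hV1⟩ := window_facts hL hs
  have hP1 : 1 ≤ bigP D := Real.one_le_exp (by positivity)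
  have hP0 : 0 < bigP D := by linarith
  have hp0 : (0 : ℝ) < x.p := by linarith
  have ht0 : 0 < s.im := by linarith
  have hΛ : 0 < ell D ^ 30 := by positivity
  -- nonnegativity facts (stated before the context grows)
  have hna : 0 ≤ bigP D ^ ((9 / 5 : ℝ) * (-s.re - 1 / 2)) := Real.rpow_nonneg hP0.le _
  have hnD : 0 ≤ (D : ℝ) * (2 * bigP D) ^ 2 := by positivity
  have hnG : 0 ≤ 4 * Real.exp 1 * ((D : ℝ) ^ 53 * bigP D ^ 2) := by positivity
  rw [norm_perronIntegrand]
  have hsw_re : (s + (((-s.re - 1 / 2 : ℝ) : ℂ) + v * I)).re = -1 / 2 := by simp; ring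
  have hZ := norm_tildeZW_le_of_re_neg_half χ x hθ hsw_re
  have hnorm : 1 + ‖s + (((-s.re - 1 / 2 : ℝ) : ℂ) + v * I)‖ ≤ (2 + 9 * t0 D) + |v| := by
    have h1 := Complex.norm_le_abs_re_add_abs_im (s + (((-s.re - 1 / 2 : ℝ) : ℂ) + v * I))
    have him : (s + (((-s.re - 1 / 2 : ℝ) : ℂ) + v * I)).im = s.im + v := by simp
    rw [hsw_re, him] at h1
    have h2 : |s.im + v| ≤ s.im + |v| := by
      calc |s.im + v| ≤ |s.im| + |v| := abs_add_le _ _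
        _ = s.im + |v| := by rw [abs_of_pos ht0]
    have h3 : |(-1 : ℝ) / 2| = 1 / 2 := by norm_num
    rw [h3] at h1
    linarith
  have hZ' : ‖tildeZW χ x (s + (((-s.re - 1 / 2 : ℝ) : ℂ) + v * I))‖
      ≤ (D : ℝ) * (2 * bigP D) ^ 2 * ((2 + 9 * t0 D) + |v|) ^ 2 := by
    refine hZ.trans ?_
    have h1 : (x.p : ℝ) ^ 2 ≤ (2 * bigP D) ^ 2 := pow_le_pow_left₀ hp0.le hp2.le 2
    have h2 : (1 + ‖s + (((-s.re - 1 / 2 : ℝ) : ℂ) + v * I)‖) ^ 2 ≤ ((2 + 9 * t0 D) + |v|) ^ 2 :=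
      pow_le_pow_left₀ (by positivity) hnorm 2
    exact mul_le_mul (mul_le_mul_of_nonneg_left h1 (Nat.cast_nonneg _)) h2 (sq_nonneg _) hnD
  have hFw := norm_FpolyBar_shift_le χ x (w := ((-s.re - 1 / 2 : ℝ) : ℂ) + v * I) hσhi
    (by simp; linarith)
  have hnZ : 0 ≤ (D : ℝ) * (2 * bigP D) ^ 2 * ((2 + 9 * t0 D) + |v|) ^ 2 := mul_nonneg hnD (sq_nonneg _)
  have hf : ‖f47 χ x s (((-s.re - 1 / 2 : ℝ) : ℂ) + v * I)‖
      ≤ (D : ℝ) * (2 * bigP D) ^ 2 * ((2 + 9 * t0 D) + |v|) ^ 2 * (D : ℝ) ^ 52 := by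
    rw [f47, norm_mul]
    exact mul_le_mul hZ' hFw (norm_nonneg _) hnZ
  have hPw : bigP D ^ ((9 / 5 : ℝ) * (-s.re - 1 / 2)) ≤ 1 :=
    Real.rpow_le_one_of_one_le_of_nonpos hP1 (by linarith only [hσlo])
  have hsq' : (-s.re - 1 / 2) ^ 2 ≤ 144 := by
    have h1 : 0 ≤ (2 - s.re) * (s.re + 10) := mul_nonneg (by linarith only [hσhi]) (by linarith only [hσlo])
    have h2 : (-s.re - 1 / 2) ^ 2 = 81 / 4 - 7 * s.re - (2 - s.re) * (s.re + 10) := by ring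
    linarith only [h1, h2, hσlo]
  have hωw := exp_factor_le hL v (u := -s.re - 1 / 2) hsq'
  have hwn : 1 ≤ ‖(((-s.re - 1 / 2 : ℝ) : ℂ)) + (v : ℂ) * I‖ := by
    have := Complex.abs_im_le_norm ((((-s.re - 1 / 2 : ℝ) : ℂ)) + (v : ℂ) * I)
    simp only [Complex.add_im, Complex.ofReal_im, Complex.mul_im, Complex.ofReal_re, Complex.I_im,
      Complex.I_re, mul_zero, mul_one, zero_add, add_zero] at this
    linarith
  have hgauss := sq_mul_exp_le (B := 2 + 9 * t0 D) hΛ (by positivity) hv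
  calc ‖f47 χ x s (((-s.re - 1 / 2 : ℝ) : ℂ) + v * I)‖ * bigP D ^ ((9 / 5 : ℝ) * (-s.re - 1 / 2)) *
        Real.exp (((-s.re - 1 / 2) ^ 2 - v ^ 2) / (4 * ell D ^ 30)) /
        ‖(((-s.re - 1 / 2 : ℝ) : ℂ)) + (v : ℂ) * I‖
      ≤ ‖f47 χ x s (((-s.re - 1 / 2 : ℝ) : ℂ) + v * I)‖ * bigP D ^ ((9 / 5 : ℝ) * (-s.re - 1 / 2)) *
        Real.exp (((-s.re - 1 / 2) ^ 2 - v ^ 2) / (4 * ell D ^ 30)) :=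
        div_le_self (mul_nonneg (mul_nonneg (norm_nonneg _) hna) (Real.exp_pos _).le) hwn
    _ ≤ (D : ℝ) * (2 * bigP D) ^ 2 * ((2 + 9 * t0 D) + |v|) ^ 2 * (D : ℝ) ^ 52 * 1 *
        (Real.exp 1 * Real.exp (-v ^ 2 / (4 * ell D ^ 30))) :=
        mul_le_mul (mul_le_mul hf hPw hna (mul_nonneg hnZ (pow_nonneg (Nat.cast_nonneg _) _)))
          hωw (Real.exp_pos _).le
          (mul_nonneg (mul_nonneg hnZ (pow_nonneg (Nat.cast_nonneg _) _)) zero_le_one)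
    _ = 4 * Real.exp 1 * ((D : ℝ) ^ 53 * bigP D ^ 2) *
        (((2 + 9 * t0 D) + |v|) ^ 2 * Real.exp (-v ^ 2 / (4 * ell D ^ 30))) := by ring
    _ ≤ 4 * Real.exp 1 * ((D : ℝ) ^ 53 * bigP D ^ 2) *
        ((2 * (2 + 9 * t0 D) ^ 2 + 24 * ell D ^ 30) * Real.exp (-(ell D ^ 20) ^ 2 / (12 * ell D ^ 30)) *
          Real.exp (-v ^ 2 / (12 * ell D ^ 30))) :=
        mul_le_mul_of_nonneg_left hgauss hnG
    _ = (4 * Real.exp 1 * ((D : ℝ) ^ 53 * bigP D ^ 2) * ((2 * (2 + 9 * t0 D) ^ 2 + 24 * ell D ^ 30) * Real.exp (-(ell D ^ 20) ^ 2 / (12 * ell D ^ 30)))) * Real.exp (-(1 / (12 * ell D ^ 30)) * v ^ 2) := by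
        rw [show -(1 / (12 * ell D ^ 30)) * v ^ 2 = -v ^ 2 / (12 * ell D ^ 30) by ring]; ring

/-- **Tails, integrated**: over any measurable `S ⊆ {|v| ≥ 𝓛²⁰}`,
`‖∫_S f₄₇(w)P^{(9/5)w}ω₁(w)dw/w‖ ≤ G_T√(12π𝓛³⁰)`, `G_T = 4e·D⁵³P²·(2B² + 24𝓛³⁰)e^{−𝓛⁴⁰/(12𝓛³⁰)}`, `B = 2 + 9t₀`. [cite: Zhang2022LandauSiegel, §4 (4.7) (proof) p. 20] -/
private theorem tail_int (hL : 100 ≤ ell D) (hθ : (psiChi χ x).IsPrimitive)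
    (hPp : bigP D < x.p) (hp2 : (x.p : ℝ) < 2 * bigP D) {s : ℂ} (hs : s ∈ Omega3 D)
    {S : Set ℝ} (hS : MeasurableSet S) (hSv : ∀ v ∈ S, ell D ^ 20 ≤ |v|) :
    ‖∫ v in S, perronIntegrand D (f47 χ x s) (((-s.re - 1 / 2 : ℝ) : ℂ) + v * I)‖
      ≤ (4 * Real.exp 1 * ((D : ℝ) ^ 53 * bigP D ^ 2) * ((2 * (2 + 9 * t0 D) ^ 2 + 24 * ell D ^ 30) * Real.exp (-(ell D ^ 20) ^ 2 / (12 * ell D ^ 30)))) * Real.sqrt (12 * π * ell D ^ 30) := by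
  have hL0 : 0 < ell D := by linarith
  have hb : 0 < 1 / (12 * ell D ^ 30) := by positivity
  have hG : 0 ≤ (4 * Real.exp 1 * ((D : ℝ) ^ 53 * bigP D ^ 2) * ((2 * (2 + 9 * t0 D) ^ 2 + 24 * ell D ^ 30) * Real.exp (-(ell D ^ 20) ^ 2 / (12 * ell D ^ 30)))) := by positivity
  have hg_int : Integrable fun v : ℝ => (4 * Real.exp 1 * ((D : ℝ) ^ 53 * bigP D ^ 2) * ((2 * (2 + 9 * t0 D) ^ 2 + 24 * ell D ^ 30) * Real.exp (-(ell D ^ 20) ^ 2 / (12 * ell D ^ 30)))) * Real.exp (-(1 / (12 * ell D ^ 30)) * v ^ 2) :=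
    (integrable_exp_neg_mul_sq hb).const_mul _
  have hg_val : ∫ v : ℝ, (4 * Real.exp 1 * ((D : ℝ) ^ 53 * bigP D ^ 2) * ((2 * (2 + 9 * t0 D) ^ 2 + 24 * ell D ^ 30) * Real.exp (-(ell D ^ 20) ^ 2 / (12 * ell D ^ 30)))) * Real.exp (-(1 / (12 * ell D ^ 30)) * v ^ 2)
      = (4 * Real.exp 1 * ((D : ℝ) ^ 53 * bigP D ^ 2) * ((2 * (2 + 9 * t0 D) ^ 2 + 24 * ell D ^ 30) * Real.exp (-(ell D ^ 20) ^ 2 / (12 * ell D ^ 30)))) * Real.sqrt (12 * π * ell D ^ 30) := by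
    rw [integral_const_mul, integral_gaussian]; congr 2; field_simp
  calc ‖∫ v in S, perronIntegrand D (f47 χ x s) (((-s.re - 1 / 2 : ℝ) : ℂ) + v * I)‖
      ≤ ∫ v in S, (4 * Real.exp 1 * ((D : ℝ) ^ 53 * bigP D ^ 2) * ((2 * (2 + 9 * t0 D) ^ 2 + 24 * ell D ^ 30) * Real.exp (-(ell D ^ 20) ^ 2 / (12 * ell D ^ 30)))) * Real.exp (-(1 / (12 * ell D ^ 30)) * v ^ 2) :=
        norm_integral_le_of_norm_le hg_int.integrableOn
          (ae_restrict_of_forall_mem hS fun v hv => tail_pt χ x hL hθ hPp hp2 hs (hSv v hv))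
    _ ≤ ∫ v : ℝ, (4 * Real.exp 1 * ((D : ℝ) ^ 53 * bigP D ^ 2) * ((2 * (2 + 9 * t0 D) ^ 2 + 24 * ell D ^ 30) * Real.exp (-(ell D ^ 20) ^ 2 / (12 * ell D ^ 30)))) * Real.exp (-(1 / (12 * ell D ^ 30)) * v ^ 2) :=
        setIntegral_le_integral hg_int (Filter.Eventually.of_forall fun v => by positivity)
    _ = (4 * Real.exp 1 * ((D : ℝ) ^ 53 * bigP D ^ 2) * ((2 * (2 + 9 * t0 D) ^ 2 + 24 * ell D ^ 30) * Real.exp (-(ell D ^ 20) ^ 2 / (12 * ell D ^ 30)))) * Real.sqrt (12 * π * ell D ^ 30) := hg_val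

end Pieces

/-- **The contour estimate of (4.7)** (`Z22:§4.u030`–`u031`, §4 p. 20: "By a trivial bound for
`ω₁(w)`, (4.5) and the residue theorem we obtain (4.7)"): for `s ∈ Ω₃`, every `ψ ∈ Ψ` and `D`
large, the integral of `Z̃(s+w,ψ)F(1−s−w,ψ̄)P^{(9/5)w}ω₁(w)/w` over the shifted contour
(`Re w = 10`, `|v| < 𝓛²⁰`; `Re w = −σ−1/2`, `|v| ≥ 𝓛²⁰`; `w = u ± i𝓛²⁰`) is `≤ C·P⁻¹`
(`c = 1`). Tails: `|Z̃| ≤ Dp²(1+|s+w|)²` on `Re(s+w) = −1/2` and `|ω₁(w)| = e^{(u²−v²)/(4𝓛³⁰)}`;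
middle segment: Stirling `|Z̃(s+w)| ≤ 2(Dp²(t+v)²/4π²)^{1/2−σ−10} ≤ 2e^{2π}P^{−20}` against
`P^{18}`, `|F(1−s−w,ψ̄)| ≤ D⁵²`; horizontal segments: `|ω₁(u ± i𝓛²⁰)| ≤ e·e^{−𝓛¹⁰/4}`.
[cite: Zhang2022LandauSiegel, §4 (4.7) (proof) p. 20] -/
theorem contour47Bound_holds : Contour47Bound := by
  refine ⟨1, one_pos, 1792 * Real.exp 1 * Real.sqrt (12 * π) + Real.exp (2 * π) * Real.exp 1 / 5
      + 576 * Real.exp 1, max 3 ⌈Real.exp 100⌉₊, fun D _ χ hD _ hp x s hs => ?_⟩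
  -- parameters
  have hD3 : 3 ≤ D := le_trans (le_max_left _ _) hD
  have hL : 100 ≤ ell D := by
    have h : Real.exp 100 ≤ D :=
      le_trans (Nat.le_ceil _) (by exact_mod_cast le_trans (le_max_right _ _) hD)
    exact (Real.le_log_iff_exp_le (lt_of_lt_of_le (Real.exp_pos _) h)).mpr h
  have hL1 : 1 ≤ ell D := by linarith
  have hL0 : 0 < ell D := by linarith
  have hDpos : (0 : ℝ) < D := by exact_mod_cast lt_of_lt_of_le (by norm_num) hD3
  have hDexp : (D : ℝ) = Real.exp (ell D) := by rw [ell, Real.exp_log hDpos]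
  have hPdef : bigP D = Real.exp (ell D ^ 9) := rfl
  have hP0 : 0 < bigP D := Real.exp_pos _
  obtain ⟨hPp, hp2⟩ := bigP_lt_p_lt hL1 x
  have hθ : (psiChi χ x).IsPrimitive := psiChiPrimitive_holds D χ x hD3 hp
  obtain ⟨hσlo, hσhi, htlo, hthi, hTbig, hV1⟩ := window_facts hL hs
  -- the five pieces
  have hMid : ‖∫ v in (-ell D ^ 20)..(ell D ^ 20), perronIntegrand D (f47 χ x s) ((10 : ℝ) + v * I)‖
      ≤ Real.exp (2 * π) * Real.exp 1 / 5 * bigP D ^ (-1 : ℝ) := by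
    have hpt : ∀ v ∈ Set.uIoc (-ell D ^ 20) (ell D ^ 20),
        ‖perronIntegrand D (f47 χ x s) ((10 : ℝ) + v * I)‖
          ≤ Real.exp (2 * π) * Real.exp 1 / 5 * ((D : ℝ) ^ 52 * bigP D ^ (-2 : ℝ)) := by
      intro v hv
      rw [Set.uIoc_of_le (by linarith)] at hv
      exact mid_pt χ x hL hθ hPp hs (abs_le.mpr ⟨le_of_lt hv.1, hv.2⟩)
    refine (intervalIntegral.norm_integral_le_of_norm_le_const hpt).trans ?_
    rw [show |ell D ^ 20 - -ell D ^ 20| = 2 * ell D ^ 20 by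
      rw [abs_of_nonneg (by linarith)]; ring]
    have key : (D : ℝ) ^ 52 * bigP D ^ (-2 : ℝ) * (2 * ell D ^ 20) ≤ bigP D ^ (-1 : ℝ) := by
      have h := arith_mid hL
      rw [← hDexp, ← hPdef] at h
      have e2 : bigP D ^ (-2 : ℝ) = (bigP D * bigP D)⁻¹ := by
        rw [Real.rpow_neg hP0.le, show (2 : ℝ) = (2 : ℕ) by norm_num, Real.rpow_natCast, pow_two]
      rw [e2, Real.rpow_neg_one]
      rw [show (D : ℝ) ^ 52 * (bigP D * bigP D)⁻¹ * (2 * ell D ^ 20)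
          = ((2 * ell D ^ 20 * (D : ℝ) ^ 52) / bigP D) * (bigP D)⁻¹ by field_simp]
      refine mul_le_of_le_one_left (inv_nonneg.mpr hP0.le) ?_
      rw [div_le_one hP0]
      exact h
    calc Real.exp (2 * π) * Real.exp 1 / 5 * ((D : ℝ) ^ 52 * bigP D ^ (-2 : ℝ)) * (2 * ell D ^ 20)
        = Real.exp (2 * π) * Real.exp 1 / 5 * ((D : ℝ) ^ 52 * bigP D ^ (-2 : ℝ) * (2 * ell D ^ 20)) := by
          ring
      _ ≤ Real.exp (2 * π) * Real.exp 1 / 5 * bigP D ^ (-1 : ℝ) :=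
          mul_le_mul_of_nonneg_left key (by positivity)
  have hHor : ∀ V : ℝ, |V| = ell D ^ 20 →
      ‖∫ u in (-s.re - 1 / 2)..10, perronIntegrand D (f47 χ x s) ((u : ℂ) + (V : ℂ) * I)‖
        ≤ 288 * Real.exp 1 * bigP D ^ (-1 : ℝ) := by
    intro V hV
    refine (intervalIntegral.norm_integral_le_of_norm_le_const fun u hu =>
      hor_pt χ x hL hθ hPp hp2 hs hV hu).trans ?_
    have hlen : |10 - (-s.re - 1 / 2)| ≤ 12 := by
      rw [abs_of_nonneg (by linarith)]; linarith
    have key : (D : ℝ) ^ 53 * bigP D ^ (18 : ℝ) * bigP D ^ 2 * t0 D ^ 2 * Real.exp (-(ell D ^ 10 / 4))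
        ≤ bigP D ^ (-1 : ℝ) := by
      have h := arith_hor hL
      rw [← hDexp, ← hPdef] at h
      rw [Real.rpow_neg_one, show (bigP D)⁻¹ = Real.exp (-(ell D ^ 9)) by rw [hPdef, Real.exp_neg]]
      exact h
    have h0 : 0 ≤ 24 * Real.exp 1 * ((D : ℝ) ^ 53 * bigP D ^ (18 : ℝ) * bigP D ^ 2 * t0 D ^ 2 *
        Real.exp (-(ell D ^ 10 / 4))) := by positivity
    calc 24 * Real.exp 1 * ((D : ℝ) ^ 53 * bigP D ^ (18 : ℝ) * bigP D ^ 2 * t0 D ^ 2 *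
          Real.exp (-(ell D ^ 10 / 4))) * |10 - (-s.re - 1 / 2)|
        ≤ 24 * Real.exp 1 * ((D : ℝ) ^ 53 * bigP D ^ (18 : ℝ) * bigP D ^ 2 * t0 D ^ 2 *
          Real.exp (-(ell D ^ 10 / 4))) * 12 := mul_le_mul_of_nonneg_left hlen h0
      _ = 288 * Real.exp 1 * ((D : ℝ) ^ 53 * bigP D ^ (18 : ℝ) * bigP D ^ 2 * t0 D ^ 2 *
          Real.exp (-(ell D ^ 10 / 4))) := by ring
      _ ≤ 288 * Real.exp 1 * bigP D ^ (-1 : ℝ) := mul_le_mul_of_nonneg_left key (by positivity)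
  have hTail_fin : (4 * Real.exp 1 * ((D : ℝ) ^ 53 * bigP D ^ 2) * ((2 * (2 + 9 * t0 D) ^ 2 + 24 * ell D ^ 30) * Real.exp (-(ell D ^ 20) ^ 2 / (12 * ell D ^ 30)))) * Real.sqrt (12 * π * ell D ^ 30)
      ≤ 896 * Real.exp 1 * Real.sqrt (12 * π) * bigP D ^ (-1 : ℝ) := by
    have h := arith_tail hL
    rw [← hDexp, ← hPdef] at h
    have hsq : Real.sqrt (12 * π * ell D ^ 30) = Real.sqrt (12 * π) * Real.sqrt (ell D ^ 30) :=
      Real.sqrt_mul (by positivity) _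
    have hT : t0 D = ell D ^ 519 := rfl
    have hex : -(ell D ^ 20) ^ 2 / (12 * ell D ^ 30) = -(ell D ^ 10 / 12) := by
      rw [div_eq_iff (by positivity)]; ring
    rw [Real.rpow_neg_one, show (bigP D)⁻¹ = Real.exp (-(ell D ^ 9)) by rw [hPdef, Real.exp_neg],
      hsq, hT, hex]
    calc 4 * Real.exp 1 * ((D : ℝ) ^ 53 * bigP D ^ 2) *
          ((2 * (2 + 9 * ell D ^ 519) ^ 2 + 24 * ell D ^ 30) * Real.exp (-(ell D ^ 10 / 12))) *
          (Real.sqrt (12 * π) * Real.sqrt (ell D ^ 30))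
        = 4 * Real.exp 1 * Real.sqrt (12 * π) * ((D : ℝ) ^ 53 * bigP D ^ 2 *
            (2 * (2 + 9 * ell D ^ 519) ^ 2 + 24 * ell D ^ 30) * Real.sqrt (ell D ^ 30) *
            Real.exp (-(ell D ^ 10 / 12))) := by ring
      _ ≤ 4 * Real.exp 1 * Real.sqrt (12 * π) * Real.exp (-(ell D ^ 9)) :=
          mul_le_mul_of_nonneg_left h (by positivity)
      _ ≤ 896 * Real.exp 1 * Real.sqrt (12 * π) * Real.exp (-(ell D ^ 9)) := by
          have : 0 ≤ Real.exp 1 * Real.sqrt (12 * π) * Real.exp (-(ell D ^ 9)) := by positivity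
          nlinarith
  have hI1 := tail_int χ x hL hθ hPp hp2 hs (S := Set.Iic (-ell D ^ 20)) measurableSet_Iic
    (fun v hv => by
      have hv' : v ≤ -ell D ^ 20 := hv
      rw [abs_of_nonpos (by linarith)]; linarith)
  have hI3 := tail_int χ x hL hθ hPp hp2 hs (S := Set.Ioi (ell D ^ 20)) measurableSet_Ioi
    (fun v hv => by
      have hv' : ell D ^ 20 < v := hv
      rw [abs_of_pos (by linarith)]; exact hv'.le)
  have hH1 : ‖∫ u in (-s.re - 1 / 2)..10, perronIntegrand D (f47 χ x s)
      ((u : ℂ) - ((ell D ^ 20 : ℝ) : ℂ) * I)‖ ≤ 288 * Real.exp 1 * bigP D ^ (-1 : ℝ) := by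
    have h := hHor (-ell D ^ 20) (by rw [abs_neg, abs_of_nonneg (by linarith)])
    have e : ∀ u : ℝ, (u : ℂ) + ((-ell D ^ 20 : ℝ) : ℂ) * I = (u : ℂ) - ((ell D ^ 20 : ℝ) : ℂ) * I := by
      intro u; push_cast; ring
    simp_rw [e] at h
    exact h
  have hH2 : ‖∫ u in (-s.re - 1 / 2)..10, perronIntegrand D (f47 χ x s)
      ((u : ℂ) + ((ell D ^ 20 : ℝ) : ℂ) * I)‖ ≤ 288 * Real.exp 1 * bigP D ^ (-1 : ℝ) :=
    hHor (ell D ^ 20) (abs_of_nonneg (by linarith))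
  -- assembly
  have hPinv : bigP D ^ (-(1 : ℝ)) = bigP D ^ (-1 : ℝ) := by norm_num
  rw [perronContour, hPinv]
  have hQ0 : 0 ≤ bigP D ^ (-1 : ℝ) := Real.rpow_nonneg hP0.le _
  calc ‖(1 / (2 * π) : ℂ) *
          ((∫ v in Set.Iic (-ell D ^ 20), perronIntegrand D (f47 χ x s) (((-s.re - 1 / 2 : ℝ) : ℂ) + v * I))
            + (∫ v in (-ell D ^ 20)..(ell D ^ 20), perronIntegrand D (f47 χ x s) (((10 : ℝ) : ℂ) + v * I))
            + ∫ v in Set.Ioi (ell D ^ 20), perronIntegrand D (f47 χ x s) (((-s.re - 1 / 2 : ℝ) : ℂ) + v * I))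
        + (1 / (2 * π * I) : ℂ) *
          ((∫ u in (-s.re - 1 / 2)..10, perronIntegrand D (f47 χ x s) ((u : ℂ) - ((ell D ^ 20 : ℝ) : ℂ) * I))
            - ∫ u in (-s.re - 1 / 2)..10, perronIntegrand D (f47 χ x s) ((u : ℂ) + ((ell D ^ 20 : ℝ) : ℂ) * I))‖
      ≤ ‖(1 / (2 * π) : ℂ)‖ *
          (‖∫ v in Set.Iic (-ell D ^ 20), perronIntegrand D (f47 χ x s) (((-s.re - 1 / 2 : ℝ) : ℂ) + v * I)‖
            + ‖∫ v in (-ell D ^ 20)..(ell D ^ 20), perronIntegrand D (f47 χ x s) (((10 : ℝ) : ℂ) + v * I)‖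
            + ‖∫ v in Set.Ioi (ell D ^ 20), perronIntegrand D (f47 χ x s) (((-s.re - 1 / 2 : ℝ) : ℂ) + v * I)‖)
        + ‖(1 / (2 * π * I) : ℂ)‖ *
          (‖∫ u in (-s.re - 1 / 2)..10, perronIntegrand D (f47 χ x s) ((u : ℂ) - ((ell D ^ 20 : ℝ) : ℂ) * I)‖
            + ‖∫ u in (-s.re - 1 / 2)..10, perronIntegrand D (f47 χ x s) ((u : ℂ) + ((ell D ^ 20 : ℝ) : ℂ) * I)‖) := by
        refine (norm_add_le _ _).trans (add_le_add ?_ ?_)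
        · rw [norm_mul]
          exact mul_le_mul_of_nonneg_left (norm_add₃_le) (norm_nonneg _)
        · rw [norm_mul]
          exact mul_le_mul_of_nonneg_left (norm_sub_le _ _) (norm_nonneg _)
    _ ≤ 1 * (896 * Real.exp 1 * Real.sqrt (12 * π) * bigP D ^ (-1 : ℝ)
            + Real.exp (2 * π) * Real.exp 1 / 5 * bigP D ^ (-1 : ℝ)
            + 896 * Real.exp 1 * Real.sqrt (12 * π) * bigP D ^ (-1 : ℝ))
        + 1 * (288 * Real.exp 1 * bigP D ^ (-1 : ℝ) + 288 * Real.exp 1 * bigP D ^ (-1 : ℝ)) := by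
        refine add_le_add ?_ ?_
        · exact mul_le_mul norm_one_div_two_pi_le
            (add_le_add (add_le_add (hI1.trans hTail_fin) hMid) (hI3.trans hTail_fin))
            (by positivity) zero_le_one
        · exact mul_le_mul norm_one_div_two_pi_I_le (add_le_add hH1 hH2) (by positivity) zero_le_one
    _ = (1792 * Real.exp 1 * Real.sqrt (12 * π) + Real.exp (2 * π) * Real.exp 1 / 5
          + 576 * Real.exp 1) * bigP D ^ (-1 : ℝ) := by ring

/-- **`Z22:§4.u031` deduction node DISCHARGED**: `Ded47 : Eq45 → Contour47Bound` (the contour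
bound holds outright, by `contour47Bound_holds`). [cite: Zhang2022LandauSiegel, §4 (4.7) (proof) p. 20] -/
theorem ded47_holds : Ded47 := fun _ => contour47Bound_holds

/-- `Ded47` — `_holds` alias of `ded47_holds` above under the fact's exact name (appended
2026-08-28, D-0026 bookkeeping: the proof term is the existing theorem of this file; no statement,
definition or attribute is edited; no new named fact; the ledger's debt table listed the fact
unproved). [cite: Zhang2022LandauSiegel, §4 (4.7) (proof) p. 20] -/
theorem _root_.Literature.NumberTheory.LFunctions.Zhang2022.Section4.Ded47_holds : Ded47 :=
  _root_.Literature.NumberTheory.LFunctions.Zhang2022.Section4.ded47_holds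

/-- **(4.7) from the contour shift alone**: `Shift47 → Eq47` (`eq47_of` with
`contour47Bound_holds`). [cite: Zhang2022LandauSiegel, §4 (4.7) (proof) p. 20] -/
theorem eq47_of_shift47 (h : Shift47) : Eq47 := eq47_of h contour47Bound_holds

/-- **(4.7) holds** (DAG `Z22:(4.7)` = `Z22:§4.u031`, [Z22 p. 20, tex L1092–L1101]): the typed
display `Section4.Eq47` is a THEOREM — the contour shift `Shift47`
(`Section4ContourShift.shift47_holds`, sz-d04) composed with the contour bound
`contour47Bound_holds` of this file via `eq47_of`.  Unconditional (no (A), every `ψ`); this is the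
closer `eq47_holds` named in the campaign's Lemma-4.4 closing protocol, consumed by
`Section4.ded44_holds`.  Nothing about Theorems 1–2 of the source is asserted.
[cite: Zhang2022LandauSiegel, §4 (4.7) p. 20] -/
theorem eq47_holds : Eq47 := eq47_of_shift47 shift47_holds

/-- `Eq47` — `_holds` alias of `eq47_holds` above under the fact's exact name (appended
2026-08-28, D-0026 bookkeeping: the proof term is the existing theorem of this file; no statement,
definition or attribute is edited; no new named fact; the ledger's debt table listed the fact
unproved). [cite: Zhang2022LandauSiegel, §4 (4.7) p. 20] -/
theorem _root_.Literature.NumberTheory.LFunctions.Zhang2022.Section4.Eq47_holds : Eq47 :=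
  _root_.Literature.NumberTheory.LFunctions.Zhang2022.Section4.eq47_holds

end Literature.NumberTheory.LFunctions.Zhang2022.Section4
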